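import Literature.Analysis.OperatorTheory.YangMillsMatrixModelEigenfunctionsOfWeak
import Literature.Analysis.OperatorTheory.YangMillsMatrixModelWeakEigenbasis
import HarnessLib

/-!
# DISCHARGE of the named fact AL1: `LuscherHamiltonianEigenfunctions k` holds for every `k`

Topic `Literature/Analysis/OperatorTheory`.  The named fact `LuscherHamiltonianEigenfunctions` of
`YangMillsMatrixModelEigenfunctions.lean` — for every `k`, `k+1` smooth, colour-rotation invariant, `L²(ℝ⁹)`-orthonormal classical
eigenfunctions of Lüscher's matrix-model Hamiltonian `𝔥 = −½Δ + ¼Σ|x_i × x_j|²` at the invariant min–max levels `physLevel 1, …, physLevel (k+1)`,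
exponentially decaying with their first and second derivatives (Reed–Simon IV Thm XIII.64 + elliptic regularity + Agmon) — is now a THEOREM
of the tree, assembled from three lanes of the cell `ym-beyond`/`ym-fleet` (crux ONE of route `LuscherReduction`, item stmt-QuantumFields-20007):

* N1–N2 (seat ym-luscher-20007-p2): `exists_weakEigenbasis_physLevel` (`YangMillsMatrixModelWeakEigenbasis.lean`) — the variational eigenvectors:
  an `L²`-orthonormal sequence of limits of invariant `C²_c` functions with the weak eigen-equation at `physLevel (k+1)` (Rellich on the core +
  the tree's `exists_core_form_eigenseq`);
* N3–N4 (seat ym-beyond-lit): `SO(3)`-averaging and hypoellipticity ⇒ smooth invariant classical representatives (`…RotationAverage.lean`,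
  `…WeakSolutions.lean`);
* N5–N6 (seat ym-luscher-20007-p1): Agmon–Caccioppoli decay of all derivatives + local Sobolev bound ⇒ `ExpDecay₂`, and the assembly
  `luscherHamiltonianEigenfunctions_of_weak_eigenseq` (`…AgmonPointwise.lean`, `…EigenfunctionsOfWeak.lean`).

★ `LuscherHamiltonianEigenfunctions_holds (k) : LuscherHamiltonianEigenfunctions k`.  Theorems only; 0 sorry; no new definitions or facts.

## References
* [ReedSimonIV1978] M. Reed, B. Simon, *Methods of Modern Mathematical Physics IV*, Thm. XIII.64.
* [Agmon1982] S. Agmon, *Lectures on Exponential Decay…*, Cor. 4.5, Thm. 5.1.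
* [GilbargTrudinger2001] D. Gilbarg, N. Trudinger, *Elliptic PDE of Second Order*, Cor. 8.11.
-/

noncomputable section

open MeasureTheory

namespace Literature.Analysis.OperatorTheory.YMMatrixModel

/-- ★★★ **The named fact AL1 holds**: for every `k`, Lüscher's matrix-model Hamiltonian has `k+1` smooth, colour-invariant,
`L²`-orthonormal, exponentially decaying classical eigenfunctions realising the invariant min–max levels `physLevel 1, …, physLevel (k+1)`.
[cite: ReedSimonIV1978, Thm. XIII.64] [cite: Agmon1982, Cor. 4.5, Thm. 5.1] [cite: GilbargTrudinger2001, Cor. 8.11] -/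
theorem LuscherHamiltonianEigenfunctions_holds (k : ℕ) : LuscherHamiltonianEigenfunctions k := by
  obtain ⟨u, hon, hcl, hweak⟩ := exists_weakEigenbasis_physLevel
  exact luscherHamiltonianEigenfunctions_of_weak_eigenseq u hon hcl hweak k

end Literature.Analysis.OperatorTheory.YMMatrixModel

end
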